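import Summits.AtomisticToContinuum.HydrodynamicLimit.Theorems.JParityClosureOddContactSymmetryCollisionCountBound
import Summits.AtomisticToContinuum.HydrodynamicLimit.Theorems.JParityClosureOddContactSymmetryWindowStaticsTwo
import Summits.AtomisticToContinuum.HydrodynamicLimit.Theorems.JParityClosureOddContactSymmetryWindowStaticsOne
import HarnessLib

/-!
# The rung-0 collision-count bound and collision tightness at global equilibrium
# (crux `JParityClosure.OddContactSymmetry`, stmt-AtomisticToContinuum-13078, line
# `equilibrium-rung-mean-variance`, transfer debt "tightness"; = `CollisionTightness` (stmt-13085) at rung 0)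

Lead prover r-1 of the crux.  Plugging the static window estimates (S1 `localGibbsLaw_closePair_le`, S2
`localGibbsLaw_twoClosePairs_le`) into the window/first-moment assembly
`lintegral_numCollisions_le_of_static` gives, for constant profiles `a, θ > 0`, `u`, reduced diameter
`0 < σ < 1/2` with `v₁σ³ ≤ 1/2`, EVERY hard-sphere flow `Φ` of `N + 1` spheres of diameter
`ε_N = σ(N+1)^{-1/3}` on `𝕋³` and every horizon `τ ≥ 0`:

* `lintegral_numCollisions_le` — `E_{G_N}[numCollisions[0, τ]] ≤ 12 v₁ ε_N² (N+1)N · 2E‖v‖ · τ`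
  (`≍ σ² (N+1)^{4/3} √θ τ`: the Boltzmann–Enskog collision frequency as an UPPER bound, with the crude
  contact factor `4 ≥ (1 - v₁σ³)^{-2}`);
* `collisionTightness_rung0` — hence the normalised count `ε_N/(N+1) · numCollisions[0, τ]` is tight under
  the homogeneous Gibbs laws, uniformly in `N` and in the flow: the rung-0 (constant-profile) case of the
  route's support item `CollisionTightness`, and the only transfer debt of the crux repaired with a
  bounded balance-exact weight (C′₃).

References: Cercignani–Illner–Pulvirenti 1994 §2.2 (Boltzmann's collision cylinder / frequency);
Gallagher–Saint-Raymond–Texier 2013, Prop. 4.1.1 and Lemma 4.1.2; Spohn 1991, Part I §2.3.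
-/

noncomputable section

open MeasureTheory Set Filter Topology
open scoped ENNReal InnerProductSpace BigOperators

namespace Summit.AtomisticToContinuum.HydrodynamicLimit.Theorems

open Literature.Analysis.FluidPDE Literature.MathematicalPhysics.KineticTheory

/-- **Rung-0 collision-count bound (first moment).**  For constant profiles `a, θ > 0`, `u`, reduced
diameter `0 < σ < 1/2` with `v₁σ³ ≤ 1/2`, every hard-sphere flow `Φ` of `N + 1` spheres of diameter
`ε = hsDiameter σ N` on `𝕋³` and every `τ ≥ 0`:
`∫ 𝟙_good · numCollisions[0, τ] dG_N ≤ 12 v₁ ε² (N+1)N · 2E‖v‖ · τ`. [folklore] -/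
theorem lintegral_numCollisions_le {σ a θ : ℝ} (hσ : 0 < σ) (hσ2 : σ < 1 / 2)
    (hlam : v₁ * σ ^ 3 ≤ 1 / 2) (ha : 0 < a) (hθ : 0 < θ) (u : V3) (N : ℕ)
    (Φ : HardSphereFlow (Torus.geometry (Fin 3)) (hsDiameter σ N) (N + 1)) {τ : ℝ} (hτ : 0 ≤ τ) :
    ∫⁻ z, Φ.good.indicator (fun z => (numCollisions (Torus.geometry (Fin 3)) (hsDiameter σ N)
        (fun s => Φ.flow s z) 0 τ : ℝ≥0∞)) z
        ∂(localGibbsLaw σ (fun _ => a) (fun _ => u) (fun _ => θ) N Φ) ≤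
      ENNReal.ofReal (12 * v₁ * hsDiameter σ N ^ 2 * ((N + 1 : ℝ) * N) *
        (2 * ∫ v, ‖v‖ ∂gaussMeasure u θ) * τ) := by
  obtain ⟨C₁, hS1⟩ := localGibbsLaw_closePair_le hσ hσ2 hlam ha hθ u N Φ
  obtain ⟨C₂, h₀, hh₀, hS2⟩ := localGibbsLaw_twoClosePairs_le hσ hσ2 hlam ha hθ u N Φ
  -- make the constants nonnegative (the bounds stay valid)
  have hF : 0 ≤ 12 * v₁ * hsDiameter σ N ^ 2 * ((N + 1 : ℝ) * N) * (2 * ∫ v, ‖v‖ ∂gaussMeasure u θ) := by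
    have := v₁_pos
    have : 0 ≤ ∫ v, ‖v‖ ∂gaussMeasure u θ := integral_nonneg fun _ => norm_nonneg _
    positivity
  have hS1' : ∀ δ : ℝ, 0 ≤ δ → localGibbsLaw σ (fun _ => a) (fun _ => u) (fun _ => θ) N Φ
      {z | ∃ i j : Fin (N + 1), i ≠ j ∧ hsDiameter σ N ≤ Torus.euclidDist (z i).1 (z j).1 ∧
        Torus.euclidDist (z i).1 (z j).1 ≤ hsDiameter σ N + (‖(z i).2‖ + ‖(z j).2‖) * δ} ≤
      ENNReal.ofReal (12 * v₁ * hsDiameter σ N ^ 2 * ((N + 1 : ℝ) * N) *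
        (2 * ∫ v, ‖v‖ ∂gaussMeasure u θ) * δ + max C₁ 0 * δ ^ 2) := fun δ hδ =>
    (hS1 δ hδ).trans (ENNReal.ofReal_le_ofReal (by nlinarith [le_max_left C₁ 0, sq_nonneg δ]))
  have hS2' : ∀ h : ℝ, 0 ≤ h → h ≤ h₀ → localGibbsLaw σ (fun _ => a) (fun _ => u) (fun _ => θ) N Φ
      {z | ∃ i j k l : Fin (N + 1), i ≠ j ∧ k ≠ l ∧ ({i, j} : Finset (Fin (N + 1))) ≠ {k, l} ∧
        Torus.euclidDist (z i).1 (z j).1 ≤ hsDiameter σ N + h ∧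
        Torus.euclidDist (z k).1 (z l).1 ≤ hsDiameter σ N + h} ≤ ENNReal.ofReal (max C₂ 0 * h ^ 2) :=
    fun h hh hh' => (hS2 h hh hh').trans
      (ENNReal.ofReal_le_ofReal (by nlinarith [le_max_left C₂ 0, sq_nonneg h]))
  exact lintegral_numCollisions_le_of_static (a := a) (θ := θ) (u := u) hσ (by norm_num at hσ2 ⊢; exact hσ2)
    hF (le_max_right _ _) (le_max_right _ _) hh₀ hS1' hS2' hτ

/-- **Collision tightness at rung 0** (the constant-profile case of the route's support item
`CollisionTightness`, stmt-AtomisticToContinuum-13085, for EVERY family of hard-sphere flows): by Markov's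
inequality and `lintegral_numCollisions_le`, `G_N[K < (ε_N/(N+1)) · numCollisions[0, τ]] ≤ δ` for
`K = 24 v₁ σ³ E‖v‖ τ / δ`, uniformly in `N`. [folklore] -/
theorem collisionTightness_rung0 (a θ : ℝ) (u : V3) (ha : 0 < a) (hθ : 0 < θ) :
    ∃ σ₀ : ℝ, 0 < σ₀ ∧ ∀ σ : ℝ, 0 < σ → σ < σ₀ →
      ∀ Φ : (N : ℕ) → HardSphereFlow (Torus.geometry (Fin 3)) (hsDiameter σ N) (N + 1),
      ∀ τ : ℝ, 0 < τ → ∀ δ : ℝ, 0 < δ → ∃ K : ℝ, ∃ N₀ : ℕ, ∀ N : ℕ, N₀ ≤ N →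
        localGibbsLaw σ (fun _ => a) (fun _ => u) (fun _ => θ) N (Φ N)
          {z | K < hsDiameter σ N / (N + 1 : ℝ) *
            (numCollisions (Torus.geometry (Fin 3)) (hsDiameter σ N) (fun s => (Φ N).flow s z) 0 τ : ℝ)} ≤
        ENNReal.ofReal δ := by
  have hv₁ := v₁_pos
  refine ⟨min (1 / 2) (1 / (2 * v₁)), lt_min (by norm_num) (by positivity), ?_⟩
  intro σ hσ hσ₀ Φ τ hτ δ hδ
  have hσ2 : σ < 1 / 2 := hσ₀.trans_le (min_le_left _ _)
  have hσv : σ < 1 / (2 * v₁) := hσ₀.trans_le (min_le_right _ _)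
  have hlam : v₁ * σ ^ 3 ≤ 1 / 2 := by
    have h1 : σ ^ 3 ≤ σ := by
      have : σ ≤ 1 := by linarith
      calc σ ^ 3 = σ * (σ * σ) := by ring
        _ ≤ σ * (1 * 1) := by gcongr
        _ = σ := by ring
    calc v₁ * σ ^ 3 ≤ v₁ * σ := by gcongr
      _ ≤ v₁ * (1 / (2 * v₁)) := by gcongr
      _ = 1 / 2 := by field_simp
  set m₁ : ℝ := ∫ v, ‖v‖ ∂gaussMeasure u θ with hm₁
  have hm₁0 : 0 ≤ m₁ := integral_nonneg fun _ => norm_nonneg _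
  set A : ℝ := 12 * v₁ * σ ^ 3 * (2 * m₁) * τ with hA
  have hA0 : 0 ≤ A := by rw [hA]; positivity
  refine ⟨A / δ + 1, 0, fun N _ => ?_⟩
  have hK : 0 < A / δ + 1 := by positivity
  set ε := hsDiameter σ N with hε
  have hε0 : 0 < ε := hsDiameter_pos hσ N
  have hε2 : ε < 2⁻¹ := (hsDiameter_le hσ.le N).trans_lt (by norm_num at hσ2 ⊢; exact hσ2)
  set μ := localGibbsLaw σ (fun _ => a) (fun _ => u) (fun _ => θ) N (Φ N) with hμ
  set f : Config (N + 1) (Fin 3) T3 → ℝ≥0∞ := (Φ N).good.indicator (fun z =>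
    (numCollisions (Torus.geometry (Fin 3)) ε (fun s => (Φ N).flow s z) 0 τ : ℝ≥0∞)) with hf
  have hfm : Measurable f := measurable_indicator_numCollisions hε2 (Φ N) 0 τ
  -- the threshold in count units
  set c : ℝ := (A / δ + 1) * (N + 1) / ε with hc
  have hc0 : 0 < c := by positivity
  -- Markov on the good set
  have hgood : μ (Φ N).goodᶜ = 0 := localGibbsLaw_compl_good_eq_zero (Φ N)
  have hsub : {z | A / δ + 1 < ε / (N + 1 : ℝ) *
      (numCollisions (Torus.geometry (Fin 3)) ε (fun s => (Φ N).flow s z) 0 τ : ℝ)} ∩ (Φ N).good ⊆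
      {z | ENNReal.ofReal c ≤ f z} := by
    rintro z ⟨hz, hg⟩
    simp only [mem_setOf_eq] at hz ⊢
    rw [hf, indicator_of_mem hg, ← ENNReal.ofReal_natCast]
    refine ENNReal.ofReal_le_ofReal ?_
    rw [hc, div_le_iff₀ hε0]
    have hN : (0 : ℝ) < N + 1 := by positivity
    have h1 : (A / δ + 1) * (N + 1) < ε / (N + 1) *
        (numCollisions (Torus.geometry (Fin 3)) ε (fun s => (Φ N).flow s z) 0 τ : ℝ) * (N + 1) :=
      mul_lt_mul_of_pos_right hz hN
    have h2 : ε / (N + 1) *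
        (numCollisions (Torus.geometry (Fin 3)) ε (fun s => (Φ N).flow s z) 0 τ : ℝ) * (N + 1) =
        (numCollisions (Torus.geometry (Fin 3)) ε (fun s => (Φ N).flow s z) 0 τ : ℝ) * ε := by
      field_simp
    rw [h2] at h1
    exact h1.le
  calc μ {z | A / δ + 1 < ε / (N + 1 : ℝ) *
        (numCollisions (Torus.geometry (Fin 3)) ε (fun s => (Φ N).flow s z) 0 τ : ℝ)}
      = μ ({z | A / δ + 1 < ε / (N + 1 : ℝ) *
        (numCollisions (Torus.geometry (Fin 3)) ε (fun s => (Φ N).flow s z) 0 τ : ℝ)} ∩ (Φ N).good) :=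
        (measure_inter_conull hgood).symm
    _ ≤ μ {z | ENNReal.ofReal c ≤ f z} := measure_mono hsub
    _ ≤ (∫⁻ z, f z ∂μ) / ENNReal.ofReal c :=
        meas_ge_le_lintegral_div hfm.aemeasurable (by simpa using hc0) ENNReal.ofReal_ne_top
    _ ≤ ENNReal.ofReal (12 * v₁ * ε ^ 2 * ((N + 1 : ℝ) * N) * (2 * m₁) * τ) / ENNReal.ofReal c := by
        gcongr
        exact lintegral_numCollisions_le hσ hσ2 hlam ha hθ u N (Φ N) hτ.le
    _ = ENNReal.ofReal (12 * v₁ * ε ^ 2 * ((N + 1 : ℝ) * N) * (2 * m₁) * τ / c) := by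
        rw [ENNReal.ofReal_div_of_pos hc0]
    _ ≤ ENNReal.ofReal δ := ENNReal.ofReal_le_ofReal ?_
  -- the arithmetic: `12 v₁ ε² (N+1) N 2m₁ τ / ((A/δ+1)(N+1)/ε) = A' · δ/(A + δ) ≤ δ` with
  -- `A' = 12 v₁ ε³ N 2 m₁ τ ≤ A = 12 v₁ σ³ 2 m₁ τ` since `(N+1) ε³ = σ³`
  have hεσ : ((N + 1 : ℕ) : ℝ) * ε ^ 3 = σ ^ 3 := succ_mul_hsDiameter_pow_three σ N
  have hN : (0 : ℝ) < N + 1 := by positivity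
  rw [hc, div_div_eq_mul_div, div_le_iff₀ (by positivity)]
  have hNε : (N : ℝ) * ε ^ 3 ≤ σ ^ 3 := by
    rw [← hεσ]; push_cast; nlinarith [pow_pos hε0 3]
  calc 12 * v₁ * ε ^ 2 * ((N + 1 : ℝ) * N) * (2 * m₁) * τ * ε
      = (12 * v₁ * (N * ε ^ 3) * (2 * m₁) * τ) * (N + 1) := by ring
    _ ≤ (12 * v₁ * σ ^ 3 * (2 * m₁) * τ) * (N + 1) := by gcongr
    _ = A * (N + 1) := by rw [hA]
    _ ≤ δ * ((A / δ + 1) * (N + 1)) := by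
        rw [show δ * ((A / δ + 1) * (N + 1)) = (A + δ) * (N + 1) by field_simp]
        nlinarith

/-- **Registered helper stub `stub_collisionTightnessRung0`** of crux stmt-AtomisticToContinuum-13078
(rung-0 collision-count bound, part 5: collision tightness at global equilibrium for every family of
hard-sphere flows — the constant-profile case of `CollisionTightness`, stmt-13085;
= `collisionTightness_rung0` in signature form). [folklore] -/
theorem stub_collisionTightnessRung0 :
    ∀ (a θ : ℝ) (u : V3), 0 < a → 0 < θ → ∃ σ₀ : ℝ, 0 < σ₀ ∧ ∀ σ : ℝ, 0 < σ → σ < σ₀ → ∀ Φ : (N : ℕ) → HardSphereFlow (Torus.geometry (Fin 3)) (hsDiameter σ N) (N + 1), ∀ τ : ℝ, 0 < τ → ∀ δ : ℝ, 0 < δ → ∃ K : ℝ, ∃ N₀ : ℕ, ∀ N : ℕ, N₀ ≤ N → localGibbsLaw σ (fun _ => a) (fun _ => u) (fun _ => θ) N (Φ N) {z | K < hsDiameter σ N / (N + 1 : ℝ) * (numCollisions (Torus.geometry (Fin 3)) (hsDiameter σ N) (fun s => (Φ N).flow s z) 0 τ : ℝ)} ≤ ENNReal.ofReal δ :=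
  fun a θ u ha hθ => collisionTightness_rung0 a θ u ha hθ

end Summit.AtomisticToContinuum.HydrodynamicLimit.Theorems

end
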